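import Mathlib
import Literature.Analysis.SpecialFunctions.BesselHeatKernelMoment
import Literature.Analysis.SpecialFunctions.BesselHeatKernelConcentration
import HarnessLib

/-!
# The radial heat kernels of real index are approximate identities as `t → 0⁺`

For `ν ≥ 0` and `x > 0` the kernels `q^{(ν)}_τ(x,z)` of `BesselHeatKernel.lean` (measure `z dz` on `(0,∞)`) satisfy, as `τ → 0⁺`:
* `tendsto_integral_besselHeatKernel_mass` — MASS: `∫_0^∞ q^{(ν)}_τ(x,z) z dz → 1`, from the EXACT harmonic moment
  `∫ q^{(ν)}_τ(x,z) z^ν z dz = x^ν` (`integral_besselHeatKernel_mul_rpow`) and concentration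
  (`tendsto_setIntegral_besselHeatKernel_far`) — no large-argument asymptotics of `I_ν` are used;
* `tendsto_integral_besselHeatKernel_approx` — APPROXIMATE IDENTITY: `∫_0^∞ q^{(ν)}_τ(x,z) G(τ,z) z dz → L` whenever `G` is
  bounded, measurable and `G(τ,z) → L` as `(τ,z) → (0⁺,x)`.
Probabilistically: the Bessel process of index `ν` started at `x > 0` is at `x` at time `0⁺` and is not killed instantly
[RevuzYor1999, Ch. XI §1].  These are the endpoint inputs of the Duhamel comparison of kernels of different index.

## References
* D. Revuz, M. Yor, *Continuous Martingales and Brownian Motion*, 3rd ed. (1999), Ch. XI §1. [RevuzYor1999]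
-/

noncomputable section

open Filter Topology Real MeasureTheory Set
open scoped Nat BigOperators

namespace Literature.Analysis.SpecialFunctions

/-! ## Mass and approximate identity -/

section Approx

variable {ν x : ℝ}

/-- **Mass**: `∫_0^∞ q^{(ν)}_τ(x,z) z dz → 1` as `τ → 0⁺` (`ν ≥ 0`, `x > 0`).  From the exact harmonic moment
`∫ q^{(ν)}_τ(x,z) z^ν z dz = x^ν` and concentration. [cite: RevuzYor1999, Ch. XI §1] -/
theorem tendsto_integral_besselHeatKernel_mass (hν : 0 ≤ ν) (hx : 0 < x) :
    Tendsto (fun τ : ℝ => ∫ z in Ioi (0 : ℝ), besselHeatKernel ν τ x z * z) (𝓝[>] 0) (𝓝 1) := by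
  have hxν : 0 < x ^ ν := Real.rpow_pos_of_pos hx ν
  rw [Metric.tendsto_nhds]
  intro ε hε
  -- `η`: the tolerance on the near region
  set η : ℝ := min (ε / 8) (1 / 2) with hη
  have hηpos : 0 < η := by positivity
  have hηε : η ≤ ε / 8 := min_le_left _ _
  have hη2 : η ≤ 1 / 2 := min_le_right _ _
  -- continuity of `z ↦ z^ν / x^ν` at `x` (value `1`)
  have hcont : ContinuousAt (fun z : ℝ => z ^ ν / x ^ ν) x :=
    ((Real.continuousAt_rpow_const x ν (Or.inl hx.ne')).div_const _)
  have hval : x ^ ν / x ^ ν = 1 := div_self hxν.ne'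
  obtain ⟨δ₀, hδ₀, hnear₀⟩ := Metric.continuousAt_iff.1 hcont η hηpos
  set δ : ℝ := min δ₀ (x / 2) with hδ_def
  have hδ : 0 < δ := by positivity
  have hnear : ∀ z, |z - x| < δ → |1 - z ^ ν / x ^ ν| < η := by
    intro z hz
    have h := hnear₀ (lt_of_lt_of_le hz (min_le_left _ _))
    rw [Real.dist_eq, hval] at h
    rwa [abs_sub_comm]
  -- the far integrals are eventually small
  set F : Set ℝ := {z : ℝ | 0 < z ∧ δ ≤ |z - x|} with hF_def
  have hFm : MeasurableSet F :=
    (measurableSet_lt measurable_const measurable_id).inter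
      (measurableSet_le measurable_const ((measurable_id.sub measurable_const).abs))
  have hfar1 := tendsto_setIntegral_besselHeatKernel_far_one hν hx hδ
  have hfarν := tendsto_setIntegral_besselHeatKernel_far hν hx hδ (p := ν + 1) (by linarith)
  have hev1 : ∀ᶠ τ in 𝓝[>] (0 : ℝ), |∫ z in F, besselHeatKernel ν τ x z * z| < η := by
    have := (Metric.tendsto_nhds.1 hfar1) η hηpos
    simpa [Real.dist_eq] using this
  have hevν : ∀ᶠ τ in 𝓝[>] (0 : ℝ), |∫ z in F, besselHeatKernel ν τ x z * z ^ (ν + 1)| < η * x ^ ν := by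
    have := (Metric.tendsto_nhds.1 hfarν) (η * x ^ ν) (by positivity)
    simpa [Real.dist_eq] using this
  filter_upwards [hev1, hevν, self_mem_nhdsWithin] with τ h1 h2 hτ
  have hτ' : (0 : ℝ) < τ := hτ
  -- abbreviations
  set K : ℝ → ℝ := fun z => besselHeatKernel ν τ x z with hK_def
  have hKnn : ∀ z, 0 < z → 0 ≤ K z := fun z hz => (besselHeatKernel_pos hν hτ' hx hz).le
  have hI1 : IntegrableOn (fun z => K z * z) (Ioi 0) := integrableOn_besselHeatKernel_mul hν hx hτ'
  have hIν : IntegrableOn (fun z => K z * z ^ ν * z) (Ioi 0) := integrableOn_besselHeatKernel_mul_rpow_mul hν hx hτ'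
  have hIν' : IntegrableOn (fun z => K z * z ^ (ν + 1)) (Ioi 0) :=
    integrableOn_besselHeatKernel_mul_rpow hν hx hτ' (by linarith)
  have hharm : ∫ z in Ioi (0 : ℝ), K z * z ^ ν * z = x ^ ν := integral_besselHeatKernel_mul_rpow hν hτ' hx
  -- `m - 1 = ∫ K z (1 - z^ν/x^ν)`
  have hdiff : (∫ z in Ioi (0 : ℝ), K z * z) - 1 = ∫ z in Ioi (0 : ℝ), K z * z * (1 - z ^ ν / x ^ ν) := by
    have e1 : ∫ z in Ioi (0 : ℝ), K z * z * (1 - z ^ ν / x ^ ν) =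
        (∫ z in Ioi (0 : ℝ), K z * z) - (∫ z in Ioi (0 : ℝ), K z * z ^ ν * z) / x ^ ν := by
      rw [div_eq_mul_inv, ← integral_mul_const, ← integral_sub hI1 (hIν.mul_const _)]
      refine integral_congr_ae (ae_of_all _ fun z => ?_)
      simp only
      field_simp
    rw [e1, hharm, div_self hxν.ne']
  -- pointwise bound on `(0,∞)`
  set g : ℝ → ℝ := fun z => 2 * η / x ^ ν * (K z * z ^ ν * z) +
    F.indicator (fun z => K z * z + (K z * z ^ (ν + 1)) / x ^ ν) z with hg_def
  have hbound : ∀ z ∈ Ioi (0 : ℝ), ‖K z * z * (1 - z ^ ν / x ^ ν)‖ ≤ g z := by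
    intro z hz
    have hz' : (0 : ℝ) < z := hz
    have hK0 : 0 ≤ K z := hKnn z hz'
    have hKz : 0 ≤ K z * z := mul_nonneg hK0 hz'.le
    have hr : 0 ≤ z ^ ν / x ^ ν := by positivity
    have hind : 0 ≤ F.indicator (fun z => K z * z + (K z * z ^ (ν + 1)) / x ^ ν) z := by
      by_cases hzF : z ∈ F
      · rw [indicator_of_mem hzF]; positivity
      · rw [indicator_of_notMem hzF]
    have hfirst : 0 ≤ 2 * η / x ^ ν * (K z * z ^ ν * z) := by positivity
    rw [Real.norm_eq_abs, abs_mul, abs_of_nonneg hKz]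
    by_cases hzn : |z - x| < δ
    · -- near: `|1 - r| < η` and `r ≥ 1/2`
      have hn := hnear z hzn
      have hr2 : 1 / 2 ≤ z ^ ν / x ^ ν := by
        have := abs_sub_lt_iff.1 hn
        linarith
      calc K z * z * |1 - z ^ ν / x ^ ν| ≤ K z * z * η := mul_le_mul_of_nonneg_left hn.le hKz
        _ ≤ K z * z * η * (2 * (z ^ ν / x ^ ν)) := by
            have hb : 0 ≤ K z * z * η := mul_nonneg hKz hηpos.le
            nlinarith [mul_nonneg hb (by linarith : (0 : ℝ) ≤ 2 * (z ^ ν / x ^ ν) - 1)]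
        _ = 2 * η / x ^ ν * (K z * z ^ ν * z) := by
            field_simp
        _ ≤ g z := by rw [hg_def]; linarith
    · -- far
      have hzF : z ∈ F := ⟨hz', not_lt.1 hzn⟩
      have habs : |1 - z ^ ν / x ^ ν| ≤ 1 + z ^ ν / x ^ ν := by
        refine abs_le.2 ⟨by linarith, by linarith⟩
      calc K z * z * |1 - z ^ ν / x ^ ν| ≤ K z * z * (1 + z ^ ν / x ^ ν) := mul_le_mul_of_nonneg_left habs hKz
        _ = K z * z + (K z * z ^ (ν + 1)) / x ^ ν := by
            rw [Real.rpow_add_one hz'.ne']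
            field_simp
        _ = F.indicator (fun z => K z * z + (K z * z ^ (ν + 1)) / x ^ ν) z := by rw [indicator_of_mem hzF]
        _ ≤ g z := by rw [hg_def]; linarith
  -- integrate the bound
  have hFsub : F ⊆ Ioi 0 := fun z hz => hz.1
  have hsum : IntegrableOn (fun z => K z * z + (K z * z ^ (ν + 1)) / x ^ ν) (Ioi 0) := hI1.add (hIν'.div_const _)
  have hgint : IntegrableOn g (Ioi 0) := by
    rw [hg_def]
    exact (hIν.const_mul _).add (hsum.indicator hFm)
  have hgval : ∫ z in Ioi (0 : ℝ), g z = 2 * η / x ^ ν * x ^ ν +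
      ((∫ z in F, K z * z) + (∫ z in F, K z * z ^ (ν + 1)) / x ^ ν) := by
    have hA : ∫ z in Ioi (0 : ℝ), g z = (∫ z in Ioi (0 : ℝ), 2 * η / x ^ ν * (K z * z ^ ν * z)) +
        ∫ z in Ioi (0 : ℝ), F.indicator (fun z => K z * z + (K z * z ^ (ν + 1)) / x ^ ν) z := by
      rw [hg_def]
      exact integral_add (hIν.const_mul _) (hsum.indicator hFm)
    have hB : ∫ z in Ioi (0 : ℝ), F.indicator (fun z => K z * z + (K z * z ^ (ν + 1)) / x ^ ν) z =
        ∫ z in F, (K z * z + (K z * z ^ (ν + 1)) / x ^ ν) := by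
      rw [integral_indicator hFm, Measure.restrict_restrict hFm, inter_eq_left.2 hFsub]
    have hIνd : IntegrableOn (fun z => K z * z ^ (ν + 1) / x ^ ν) (Ioi 0) := hIν'.div_const _
    have hC : ∫ z in F, (K z * z + (K z * z ^ (ν + 1)) / x ^ ν) =
        (∫ z in F, K z * z) + (∫ z in F, K z * z ^ (ν + 1)) / x ^ ν := by
      rw [integral_add (hI1.mono_set hFsub) (hIνd.mono_set hFsub), integral_div]
    rw [hA, integral_const_mul, hharm, hB, hC]
  have hmain : |(∫ z in Ioi (0 : ℝ), K z * z) - 1| ≤ 2 * η + (η + η) := by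
    rw [hdiff]
    calc |∫ z in Ioi (0 : ℝ), K z * z * (1 - z ^ ν / x ^ ν)|
        = ‖∫ z in Ioi (0 : ℝ), K z * z * (1 - z ^ ν / x ^ ν)‖ := (Real.norm_eq_abs _).symm
      _ ≤ ∫ z in Ioi (0 : ℝ), g z := norm_integral_le_of_norm_le hgint (ae_restrict_of_forall_mem measurableSet_Ioi hbound)
      _ = 2 * η / x ^ ν * x ^ ν + ((∫ z in F, K z * z) + (∫ z in F, K z * z ^ (ν + 1)) / x ^ ν) := hgval
      _ ≤ 2 * η + (η + η) := by
          have e1 : 2 * η / x ^ ν * x ^ ν = 2 * η := by field_simp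
          rw [e1]
          have b1 : ∫ z in F, K z * z ≤ η := (le_abs_self _).trans h1.le
          have b2 : (∫ z in F, K z * z ^ (ν + 1)) / x ^ ν ≤ η := by
            rw [div_le_iff₀ hxν]
            exact (le_abs_self _).trans h2.le
          linarith
  rw [Real.dist_eq]
  linarith

/-- **Approximate identity**: if `G` is bounded on `(0,∞)`, measurable, and `G(τ,z) → L` as `(τ,z) → (0⁺,x)`, then
`∫_0^∞ q^{(ν)}_τ(x,z) G(τ,z) z dz → L` as `τ → 0⁺` (`ν ≥ 0`, `x > 0`). [cite: RevuzYor1999, Ch. XI §1] -/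
theorem tendsto_integral_besselHeatKernel_approx (hν : 0 ≤ ν) (hx : 0 < x) {G : ℝ → ℝ → ℝ} {L M : ℝ}
    (hGm : ∀ τ, 0 < τ → AEStronglyMeasurable (G τ) (volume.restrict (Ioi 0)))
    (hGb : ∀ τ z, 0 < τ → 0 < z → |G τ z| ≤ M)
    (hGc : ∀ ε > 0, ∃ δ > 0, ∀ τ z, 0 < τ → τ < δ → 0 < z → |z - x| < δ → |G τ z - L| < ε) :
    Tendsto (fun τ : ℝ => ∫ z in Ioi (0 : ℝ), besselHeatKernel ν τ x z * G τ z * z) (𝓝[>] 0) (𝓝 L) := by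
  have hM : 0 ≤ M := (abs_nonneg _).trans (hGb 1 1 one_pos one_pos)
  have hmass := tendsto_integral_besselHeatKernel_mass hν hx
  rw [Metric.tendsto_nhds]
  intro ε hε
  set η : ℝ := min (ε / (4 * (M + |L| + 1))) 1 with hη
  have hηpos : 0 < η := by positivity
  have hηε : η ≤ ε / (4 * (M + |L| + 1)) := min_le_left _ _
  have hη1 : η ≤ 1 := min_le_right _ _
  obtain ⟨δ, hδ, hG⟩ := hGc η hηpos
  set F : Set ℝ := {z : ℝ | 0 < z ∧ δ ≤ |z - x|} with hF_def
  have hFm : MeasurableSet F :=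
    (measurableSet_lt measurable_const measurable_id).inter
      (measurableSet_le measurable_const ((measurable_id.sub measurable_const).abs))
  have hFsub : F ⊆ Ioi 0 := fun z hz => hz.1
  have hev1 : ∀ᶠ τ in 𝓝[>] (0 : ℝ), |∫ z in F, besselHeatKernel ν τ x z * z| < η := by
    have := (Metric.tendsto_nhds.1 (tendsto_setIntegral_besselHeatKernel_far_one hν hx hδ)) η hηpos
    simpa [Real.dist_eq] using this
  have hev2 : ∀ᶠ τ in 𝓝[>] (0 : ℝ), |(∫ z in Ioi (0 : ℝ), besselHeatKernel ν τ x z * z) - 1| < η := by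
    have := (Metric.tendsto_nhds.1 hmass) η hηpos
    simpa [Real.dist_eq] using this
  have hev3 : Ioo (0 : ℝ) δ ∈ 𝓝[>] (0 : ℝ) := Ioo_mem_nhdsGT hδ
  filter_upwards [hev1, hev2, hev3] with τ h1 h2 hτ
  have hτ' : 0 < τ := hτ.1
  set K : ℝ → ℝ := fun z => besselHeatKernel ν τ x z with hK_def
  have hKnn : ∀ z, 0 < z → 0 ≤ K z := fun z hz => (besselHeatKernel_pos hν hτ' hx hz).le
  have hI1 : IntegrableOn (fun z => K z * z) (Ioi 0) := integrableOn_besselHeatKernel_mul hν hx hτ'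
  have hIG : IntegrableOn (fun z => K z * G τ z * z) (Ioi 0) := by
    have h : IntegrableOn (fun z => M * (K z * z)) (Ioi 0) := hI1.const_mul M
    refine Integrable.mono' h ?_ ?_
    · exact (((continuous_besselHeatKernel_right hν τ x).aestronglyMeasurable.mul (hGm τ hτ')).mul
        continuous_id.aestronglyMeasurable)
    · refine ae_restrict_of_forall_mem measurableSet_Ioi fun z hz => ?_
      have hz' : (0 : ℝ) < z := hz
      rw [Real.norm_eq_abs, show K z * G τ z * z = G τ z * (K z * z) by ring, abs_mul,
        abs_of_nonneg (mul_nonneg (hKnn z hz') hz'.le)]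
      exact mul_le_mul_of_nonneg_right (hGb τ z hτ' hz') (mul_nonneg (hKnn z hz') hz'.le)
  -- decomposition `∫ K G z - L = ∫ K (G - L) z + L (m - 1)`
  have hdec : (∫ z in Ioi (0 : ℝ), K z * G τ z * z) - L =
      (∫ z in Ioi (0 : ℝ), K z * z * (G τ z - L)) + L * ((∫ z in Ioi (0 : ℝ), K z * z) - 1) := by
    have e : ∫ z in Ioi (0 : ℝ), K z * z * (G τ z - L) =
        (∫ z in Ioi (0 : ℝ), K z * G τ z * z) - L * ∫ z in Ioi (0 : ℝ), K z * z := by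
      rw [← integral_const_mul, ← integral_sub hIG (hI1.const_mul L)]
      refine integral_congr_ae (ae_of_all _ fun z => ?_)
      simp only
      ring
    rw [e]; ring
  -- pointwise bound for the first term
  set g : ℝ → ℝ := fun z => η * (K z * z) + F.indicator (fun z => (M + |L|) * (K z * z)) z with hg_def
  have hbound : ∀ z ∈ Ioi (0 : ℝ), ‖K z * z * (G τ z - L)‖ ≤ g z := by
    intro z hz
    have hz' : (0 : ℝ) < z := hz
    have hK0 : 0 ≤ K z := hKnn z hz'
    have hKz : 0 ≤ K z * z := mul_nonneg hK0 hz'.le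
    rw [Real.norm_eq_abs, abs_mul, abs_of_nonneg hKz]
    have hGL : |G τ z - L| ≤ M + |L| := (abs_sub _ _).trans (add_le_add (hGb τ z hτ' hz') le_rfl)
    by_cases hzn : |z - x| < δ
    · have hn := hG τ z hτ' hτ.2 hz' hzn
      have hind : 0 ≤ F.indicator (fun z => (M + |L|) * (K z * z)) z := by
        by_cases hzF : z ∈ F
        · rw [indicator_of_mem hzF]; positivity
        · rw [indicator_of_notMem hzF]
      calc K z * z * |G τ z - L| ≤ K z * z * η := mul_le_mul_of_nonneg_left hn.le hKz
        _ ≤ g z := by rw [hg_def]; linarith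
    · have hzF : z ∈ F := ⟨hz', not_lt.1 hzn⟩
      calc K z * z * |G τ z - L| ≤ K z * z * (M + |L|) := mul_le_mul_of_nonneg_left hGL hKz
        _ = F.indicator (fun z => (M + |L|) * (K z * z)) z := by rw [indicator_of_mem hzF]; ring
        _ ≤ g z := by
            rw [hg_def]
            have : 0 ≤ η * (K z * z) := by positivity
            linarith
  have hprod : IntegrableOn (fun z => (M + |L|) * (K z * z)) (Ioi 0) := hI1.const_mul _
  have hgint : IntegrableOn g (Ioi 0) := by
    rw [hg_def]
    exact (hI1.const_mul η).add (hprod.indicator hFm)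
  have hgval : ∫ z in Ioi (0 : ℝ), g z = η * (∫ z in Ioi (0 : ℝ), K z * z) + (M + |L|) * ∫ z in F, K z * z := by
    have hA : ∫ z in Ioi (0 : ℝ), g z = (∫ z in Ioi (0 : ℝ), η * (K z * z)) +
        ∫ z in Ioi (0 : ℝ), F.indicator (fun z => (M + |L|) * (K z * z)) z := by
      rw [hg_def]
      exact integral_add (hI1.const_mul η) (hprod.indicator hFm)
    have hB : ∫ z in Ioi (0 : ℝ), F.indicator (fun z => (M + |L|) * (K z * z)) z = ∫ z in F, (M + |L|) * (K z * z) := by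
      rw [integral_indicator hFm, Measure.restrict_restrict hFm, inter_eq_left.2 hFsub]
    rw [hA, hB, integral_const_mul, integral_const_mul]
  have hm_le : (∫ z in Ioi (0 : ℝ), K z * z) ≤ 2 := by
    have := abs_sub_lt_iff.1 h2
    linarith
  have hfirst : |∫ z in Ioi (0 : ℝ), K z * z * (G τ z - L)| ≤ η * 2 + (M + |L|) * η := by
    calc |∫ z in Ioi (0 : ℝ), K z * z * (G τ z - L)|
        = ‖∫ z in Ioi (0 : ℝ), K z * z * (G τ z - L)‖ := (Real.norm_eq_abs _).symm
      _ ≤ ∫ z in Ioi (0 : ℝ), g z := norm_integral_le_of_norm_le hgint (ae_restrict_of_forall_mem measurableSet_Ioi hbound)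
      _ = η * (∫ z in Ioi (0 : ℝ), K z * z) + (M + |L|) * ∫ z in F, K z * z := hgval
      _ ≤ η * 2 + (M + |L|) * η := by
          have b1 : ∫ z in F, K z * z ≤ η := (le_abs_self _).trans h1.le
          nlinarith [abs_nonneg L]
  rw [Real.dist_eq, hdec]
  have hsecond : |L * ((∫ z in Ioi (0 : ℝ), K z * z) - 1)| ≤ |L| * η := by
    rw [abs_mul]; exact mul_le_mul_of_nonneg_left h2.le (abs_nonneg L)
  calc |(∫ z in Ioi (0 : ℝ), K z * z * (G τ z - L)) + L * ((∫ z in Ioi (0 : ℝ), K z * z) - 1)|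
      ≤ |∫ z in Ioi (0 : ℝ), K z * z * (G τ z - L)| + |L * ((∫ z in Ioi (0 : ℝ), K z * z) - 1)| := abs_add_le _ _
    _ ≤ η * 2 + (M + |L|) * η + |L| * η := add_le_add hfirst hsecond
    _ = η * (2 + M + 2 * |L|) := by ring
    _ ≤ ε / (4 * (M + |L| + 1)) * (2 + M + 2 * |L|) :=
        mul_le_mul_of_nonneg_right hηε (by positivity)
    _ < ε := by
        rw [div_mul_eq_mul_div, div_lt_iff₀ (by positivity)]
        nlinarith [abs_nonneg L]

end Approx

end Literature.Analysis.SpecialFunctions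

end
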